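import Mathlib
import Summits.ResolutionOfSingularities.ResolutionOfSingularities.Theorems.HomologicalConductorPersistenceCusp34Conductor
import Summits.ResolutionOfSingularities.ResolutionOfSingularities.Theorems.HomologicalConductorPersistenceConductorStablyAnnihilates
import Literature.AlgebraicGeometry.Resolution.AdicNoetherian

/-!
# K-C3 §H2L hypothesis `hJ` for the cusp: `(z,t)²·C ⊆ ca(C)`, `C = k⟦z,t⟧/(z³ + t⁴)` — FACT-FREE

[OURS · L1 w44b] Composition of res-type-011's fact-free conductor lemma
`PersistenceConductorStablyAnnihilates.mem_cohomologyAnnihilator_of_conductor` (`𝔠 ⊆ ca(R)` for an injective map into a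
principal ideal local domain) with the K2b bricks (`Cusp34.normQuotHom` injective, every `c ∈ (z̄,t̄)²` a conductor element,
`Cusp34.conductor_hypotheses_of_mem_sq`): the hypothesis
`hJ : ((span {X 0, X 1}) ^ 2).map (Ideal.Quotient.mk (span {hP})) ≤ cohomologyAnnihilator (k⟦z,t⟧ ⧸ (hP))` of
`PersistenceKC3LowerFactFree.span_le_cohomologyAnnihilator_of_isLocalization_xy_of_le` for `hP = X 0 ^ 3 + X 1 ^ 4`, in both
spellings (`hP` as a power series, and as the coercion of the polynomial `X 0 ^ 3 + X 1 ^ 4 : MvPolynomial (Fin 2) k`), plus the two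
side facts `constantCoeff hP = 0`, `hP ≠ 0`.  No named fact is used.  NOT a statement of the manuscript under review.
-/

set_option linter.dupNamespace false

noncomputable section

namespace Summit.ResolutionOfSingularities.ResolutionOfSingularities.Theorems.HomologicalConductor.Cusp34

open Literature.RingTheory.CohomologyAnnihilator Literature.AlgebraicGeometry.Resolution
open Summit.ResolutionOfSingularities.ResolutionOfSingularities.Theorems.HomologicalConductor.PersistenceConductorStablyAnnihilates

universe u

variable (k : Type u) [Field k]

/-- **`hJ` for the cusp (power-series spelling): `(z̄,t̄)² ⊆ ca(k⟦z,t⟧/(z³+t⁴))`.** [OURS] -/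
theorem span_sq_map_mk_le_cohomologyAnnihilator_cusp34 :
    ((Ideal.span {(MvPowerSeries.X 0 : MvPowerSeries (Fin 2) k), MvPowerSeries.X 1}) ^ 2).map
        (Ideal.Quotient.mk
          (Ideal.span {(MvPowerSeries.X 0 ^ 3 + MvPowerSeries.X 1 ^ 4 : MvPowerSeries (Fin 2) k)})) ≤
      cohomologyAnnihilator (MvPowerSeries (Fin 2) k ⧸
        Ideal.span {(MvPowerSeries.X 0 ^ 3 + MvPowerSeries.X 1 ^ 4 : MvPowerSeries (Fin 2) k)}) := by
  intro c hc
  haveI : IsNoetherianRing (MvPowerSeries (Fin 2) k) := isNoetherianRing_mvPowerSeries (Fin 2) (R := k)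
  letI : Algebra (MvPowerSeries (Fin 2) k ⧸
      Ideal.span {(MvPowerSeries.X 0 ^ 3 + MvPowerSeries.X 1 ^ 4 : MvPowerSeries (Fin 2) k)}) (PowerSeries k) :=
    (normQuotHom k).toAlgebra
  rw [Ideal.map_pow, map_mk_span_pair] at hc
  obtain ⟨hinj, hcond⟩ := conductor_hypotheses_of_mem_sq k c hc
  exact mem_cohomologyAnnihilator_of_conductor hinj hcond

/-- The polynomial `z³ + t⁴` coerces to the power series `z³ + t⁴`. [OURS] -/
theorem coe_cusp34_poly :
    ((MvPolynomial.X 0 ^ 3 + MvPolynomial.X 1 ^ 4 : MvPolynomial (Fin 2) k) : MvPowerSeries (Fin 2) k) =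
      MvPowerSeries.X 0 ^ 3 + MvPowerSeries.X 1 ^ 4 := by
  rw [MvPolynomial.coe_add, MvPolynomial.coe_pow, MvPolynomial.coe_pow, MvPolynomial.coe_X, MvPolynomial.coe_X]

/-- **`hJ` for the cusp, polynomial spelling** (`hP := X 0 ^ 3 + X 1 ^ 4 : MvPolynomial (Fin 2) k` coerced, verbatim the `hJ` of
`span_le_cohomologyAnnihilator_of_isLocalization_xy_of_le`). [OURS] -/
theorem span_sq_map_mk_le_cohomologyAnnihilator_cusp34_poly :
    ((Ideal.span {(MvPowerSeries.X 0 : MvPowerSeries (Fin 2) k), MvPowerSeries.X 1}) ^ 2).map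
        (Ideal.Quotient.mk (Ideal.span
          {((MvPolynomial.X 0 ^ 3 + MvPolynomial.X 1 ^ 4 : MvPolynomial (Fin 2) k) : MvPowerSeries (Fin 2) k)})) ≤
      cohomologyAnnihilator (MvPowerSeries (Fin 2) k ⧸ Ideal.span
        {((MvPolynomial.X 0 ^ 3 + MvPolynomial.X 1 ^ 4 : MvPolynomial (Fin 2) k) : MvPowerSeries (Fin 2) k)}) := by
  have key : ∀ J : Ideal (MvPowerSeries (Fin 2) k),
      J = Ideal.span {(MvPowerSeries.X 0 ^ 3 + MvPowerSeries.X 1 ^ 4 : MvPowerSeries (Fin 2) k)} →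
        ((Ideal.span {(MvPowerSeries.X 0 : MvPowerSeries (Fin 2) k), MvPowerSeries.X 1}) ^ 2).map
            (Ideal.Quotient.mk J) ≤ cohomologyAnnihilator (MvPowerSeries (Fin 2) k ⧸ J) := by
    rintro J rfl
    exact span_sq_map_mk_le_cohomologyAnnihilator_cusp34 k
  exact key _ (by rw [coe_cusp34_poly])

/-- Side fact: `z³ + t⁴` has no constant term. [OURS] -/
theorem constantCoeff_cusp34_poly :
    MvPolynomial.constantCoeff (MvPolynomial.X 0 ^ 3 + MvPolynomial.X 1 ^ 4 : MvPolynomial (Fin 2) k) = 0 := by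
  simp [MvPolynomial.constantCoeff_X]

/-- Side fact: `z³ + t⁴ ≠ 0`. [OURS] -/
theorem cusp34_poly_ne_zero :
    (MvPolynomial.X 0 ^ 3 + MvPolynomial.X 1 ^ 4 : MvPolynomial (Fin 2) k) ≠ 0 := by
  intro h
  have h3 := congrArg (MvPolynomial.coeff (Finsupp.single (0 : Fin 2) 3)) h
  have hne : (Finsupp.single (1 : Fin 2) 4 : Fin 2 →₀ ℕ) ≠ Finsupp.single (0 : Fin 2) 3 := by
    intro h01
    have := Finsupp.ext_iff.mp h01 0
    simp at this
  rw [MvPolynomial.coeff_add, MvPolynomial.coeff_X_pow, MvPolynomial.coeff_X_pow, if_pos rfl, if_neg hne, add_zero,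
    MvPolynomial.coeff_zero] at h3
  exact one_ne_zero h3

end Summit.ResolutionOfSingularities.ResolutionOfSingularities.Theorems.HomologicalConductor.Cusp34

end
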